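import Mathlib

/-!
# Sketch_utd_idea_g71 — the pro-`3` ring-class tower: why the `+`-sign unit obstruction never fires,
# and why the Kolyvagin derivative loses nothing on it

utd-idea g71 (2026-08-30) · crux `stmt-BirchSwinnertonDyer-24737`
(`Summit.BirchSwinnertonDyer.BirchSwinnertonDyer.Theses.UniversalToricDescent.TwinAlgMuZeroAtThree`) ·
card `Cruxes/TwinAlgMuZeroAtThree/Ideas/one-point-squeeze.md`, residual **R⁺** (g70 text, ll. 98–104,
falsifier ll. 398–402): «for the `+` sign, over a completion `L_w̃ ⊃ ℚ₃` of a ring-class layer whose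
unramified degree `n_w` is `≡ 0 (mod 4)`, the `+` norm subgroup is not free/induced — Kitajima–Otsuki:
`φ + φ⁻¹` is a zero-divisor of `ℤ₃[Gal(k/ℚ₃)]` — and no Chebotarev side condition forcing `4 ∤ n_w` is known».

RESOLUTION (g71): run the Heegner–Kolyvagin derivative over the PRO-`3` ring-class tower
`L = K_m · K[n]₍₃₎` (`K[n]₍₃₎` = fixed field of the prime-to-`3` part of the abelian group `Gal(K[n]/K)`).
Then `Gal(L/K)` is a `3`-group, so every residue degree above the split prime `𝔭 ∣ 3` is a power of `3`,
hence ODD, and the catalogued obstruction is vacuous: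

* `one_add_sq_mul_alt_sum`, `isUnit_one_add_sq_of_odd`, `isUnit_add_inv_of_odd` — Kitajima–Otsuki,
  *Tokyo J. Math.* (arXiv:1607.03612) Lemma 3.6 (1): if `φ^{2d} = 1` with `d` odd and `2` is invertible then
  `(1 + φ²)(1 - φ² + φ⁴ - ⋯ + φ^{2d-2}) = 2`, so `1 + φ²` and `φ + φ⁻¹ = φ⁻¹(1 + φ²)` are units;
  `MonoidAlgebra.isUnit_of_add_of_inv` is the group-ring form (`g` of odd order, `2 ∈ kˣ`, e.g. `k = ℤ₃`);
* `one_add_mul_alt_sum_eq_zero` — the complementary identity behind Lemma 3.6 (2) (`4 ∣ d`: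
  `(1 + φ²) · Σ_{j<d/2} (-φ²)^j = 0`), recorded to show exactly what the pro-`3` tower avoids;
* `kolyvaginDerivative_crt`, `kolyvaginDerivative_crt_dvd` — nothing is lost mod `3^a`: for commuting
  `s, t` with `s^a = 1`, `t^e = 1` (think `σ_ℓ = s·t`, `#G_ℓ = ℓ + 1 = 3^a · e`, `(3, e) = 1` — the lemma
  itself needs no coprimality hypothesis beyond the CRT reindexing, which uses `Nat.Coprime a e`)
  `D_{st} := Σ_{i < ae} i·(st)^i = (Σ_{j<a} j·s^j) · (Σ_{k<e} t^k) + a · Q`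
  in the group ring: the Kolyvagin derivative of the full ring-class layer is, modulo `a = 3^{v₃(ℓ+1)}`
  (⊇ the modulus `3^M`, `3^M ∣ ℓ+1`), the derivative of the `3`-part applied to the TRACE to the pro-`3`
  sub-layer — and traces of Heegner points are again Heegner-type norm-compatible points.

The pro-`3` tower is not a convenience but a necessity: for `K = ℚ(√-155)` (`d_K` odd, `3` split, `Cl_K ≅ ℤ/4`
generated by `[𝔭₃]`, reduced forms `(1,1,39), (3,±1,13), (5,5,9)`) the residue degree of `𝔭₃` in `K[1]` is already `4`, so
`4 ∣ n_w` at EVERY Kolyvagin prime and no Chebotarev side condition on `ℓ` can dodge the zero-divisor; on the pro-`3` tower the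
same prime contributes unramified degree `3^{v₃(n_w)}`.

So R⁺ is retired as a kill shape; what remains is the PORT (a′)⁺: the `+` signed structure theorem over an
unramified base of `3`-power degree in the relative Lubin–Tate (anticyclotomic) direction at `p = 3`.
No `sorry`, no new axioms, Mathlib only.
-/

open Finset

namespace Summit.BirchSwinnertonDyer.BirchSwinnertonDyer.Cruxes.TwinAlgMuZeroAtThree.OnePointSqueeze.ProThreeTower

section UnitLemma

variable {R : Type*} [Ring R]

/-- Kitajima–Otsuki Lemma 3.6 (1), the identity: if `x ^ (2d) = 1` with `d` odd then
`(1 + x²) · Σ_{j<d} (-x²)^j = 2`. -/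
theorem one_add_sq_mul_alt_sum (x : R) {d : ℕ} (hd : Odd d) (hx : x ^ (2 * d) = 1) :
    (1 + x ^ 2) * (∑ j ∈ range d, (-x ^ 2) ^ j) = 2 := by
  have h := mul_neg_geom_sum (-x ^ 2) d
  rw [sub_neg_eq_add] at h
  rw [h, neg_pow, hd.neg_one_pow, ← pow_mul, hx]
  norm_num

/-- The complementary identity (Kitajima–Otsuki Lemma 3.6 (2)): if `y ^ (2m) = 1` then
`(1 + y) · Σ_{j<2m} (-y)^j = 0`; with `y = φ²`, `4m = d` this exhibits `1 + φ²` (hence `φ + φ⁻¹`) as a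
zero-divisor as soon as the alternating sum is non-zero, i.e. as soon as `φ²` has exact order `2m`. -/
theorem one_add_mul_alt_sum_eq_zero (y : R) {m : ℕ} (hy : y ^ (2 * m) = 1) :
    (1 + y) * (∑ j ∈ range (2 * m), (-y) ^ j) = 0 := by
  have h := mul_neg_geom_sum (-y) (2 * m)
  rw [sub_neg_eq_add] at h
  rw [h, (even_two_mul m).neg_pow, hy, sub_self]

variable {S : Type*} [CommRing S]

/-- If `2` is a unit, `d` is odd and `x ^ (2d) = 1`, then `1 + x²` is a unit. -/
theorem isUnit_one_add_sq_of_odd (h2 : IsUnit (2 : S)) (x : S) {d : ℕ} (hd : Odd d)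
    (hx : x ^ (2 * d) = 1) : IsUnit (1 + x ^ 2) := by
  have h := one_add_sq_mul_alt_sum x hd hx
  have h' : IsUnit ((1 + x ^ 2) * ∑ j ∈ range d, (-x ^ 2) ^ j) := by rw [h]; exact h2
  exact isUnit_of_mul_isUnit_left h'

/-- The `φ + φ⁻¹` form: for a unit `u` with `u ^ (2d) = 1`, `d` odd, `2` invertible, `u + u⁻¹` is a unit. -/
theorem isUnit_add_inv_of_odd (h2 : IsUnit (2 : S)) (u : Sˣ) {d : ℕ} (hd : Odd d)
    (hu : (u : S) ^ (2 * d) = 1) : IsUnit ((u : S) + (↑u⁻¹ : S)) := by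
  have h1 : IsUnit (1 + (u : S) ^ 2) := isUnit_one_add_sq_of_odd h2 (u : S) hd hu
  have hfac : (u : S) + (↑u⁻¹ : S) = (↑u⁻¹ : S) * (1 + (u : S) ^ 2) := by
    rw [mul_add, mul_one, sq, ← mul_assoc, Units.inv_mul, one_mul, add_comm (u : S)]
  rw [hfac]
  exact (Units.isUnit u⁻¹).mul h1

/-- A power of `3` is odd: on the pro-`3` ring-class tower every unramified local degree is `3^s`. -/
theorem odd_three_pow (s : ℕ) : Odd (3 ^ s) := Odd.pow (by decide)

/-- Residue degrees on the pro-`3` tower divide `[L:K] = 3^s`, hence are odd. -/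
theorem odd_of_dvd_three_pow {d s : ℕ} (h : d ∣ 3 ^ s) : Odd d := by
  obtain ⟨t, -, rfl⟩ := (Nat.dvd_prime_pow Nat.prime_three).1 h
  exact odd_three_pow t

/-- `¬ 4 ∣ 3^s`: Kitajima–Otsuki's zero-divisor case `d ≡ 0 (mod 4)` never occurs on the pro-`3` tower. -/
theorem not_four_dvd_three_pow (s : ℕ) : ¬ 4 ∣ 3 ^ s := by
  intro h
  have h2 : 2 ∣ 3 ^ s := dvd_trans (by norm_num) h
  exact (odd_three_pow s).not_two_dvd_nat h2

end UnitLemma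

section GroupRing

variable {k : Type*} [CommRing k] {G : Type*} [CommGroup G]

/-- Group-ring form of Kitajima–Otsuki Lemma 3.6 (1): in `k[G]` with `2 ∈ kˣ` (e.g. `k = ℤ₃`), for `g` of
odd order (e.g. the Frobenius of an unramified extension of `ℚ₃` of `3`-power degree),
`g + g⁻¹` is a unit. -/
theorem MonoidAlgebra.isUnit_of_add_of_inv (h2 : IsUnit (2 : k)) (g : G) (hg : Odd (orderOf g)) :
    IsUnit (MonoidAlgebra.of k G g + MonoidAlgebra.of k G g⁻¹) := by
  have h2' : IsUnit (2 : MonoidAlgebra k G) := by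
    have := h2.map (algebraMap k (MonoidAlgebra k G))
    rwa [map_ofNat] at this
  have hpow : (MonoidAlgebra.of k G g) ^ (2 * orderOf g) = 1 := by
    rw [← map_pow, pow_mul', pow_orderOf_eq_one, one_pow, map_one]
  have h1 : IsUnit (1 + (MonoidAlgebra.of k G g) ^ 2) := isUnit_one_add_sq_of_odd h2' _ hg hpow
  have hfac : MonoidAlgebra.of k G g + MonoidAlgebra.of k G g⁻¹
      = MonoidAlgebra.of k G g⁻¹ * (1 + (MonoidAlgebra.of k G g) ^ 2) := by
    rw [mul_add, mul_one, sq, ← mul_assoc, ← map_mul, inv_mul_cancel, map_one, one_mul,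
      add_comm (MonoidAlgebra.of k G g)]
  rw [hfac]
  exact ((Group.isUnit g⁻¹).map (MonoidAlgebra.of k G)).mul h1

end GroupRing

section KolyvaginDerivative

variable {k : Type*} [CommRing k] {G : Type*} [CommMonoid G]

/-- CRT factorisation of the Kolyvagin derivative.  For commuting `s, t` (here: in a commutative monoid)
with `s ^ a = 1`, `t ^ e = 1`, `a` and `e` coprime, in the monoid algebra `k[G]`:
`Σ_{i<ae} i·(st)^i = (Σ_{j<a} j·s^j)·(Σ_{k<e} t^k) + a·Q` with the explicit
`Q = Σ_{i<ae} ⌊i/a⌋·(st)^i`.  (Apply with `G = Gal(K[ℓ]/K[1]) = ⟨σ_ℓ⟩` of order `ℓ+1 = 3^a'·e`,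
`a = 3^a'`, `s, t` the CRT components of `σ_ℓ`: `D_{σ_ℓ} ≡ D_s · N_{⟨t⟩}` modulo `3^{a'}`.) -/
theorem kolyvaginDerivative_crt {a e : ℕ} (hae : Nat.Coprime a e) (s t : G)
    (hs : s ^ a = 1) (ht : t ^ e = 1) :
    (∑ i ∈ range (a * e), (i : MonoidAlgebra k G) * MonoidAlgebra.of k G ((s * t) ^ i))
      = (∑ j ∈ range a, (j : MonoidAlgebra k G) * MonoidAlgebra.of k G (s ^ j))
          * (∑ l ∈ range e, MonoidAlgebra.of k G (t ^ l))
        + (a : MonoidAlgebra k G)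
          * ∑ i ∈ range (a * e), ((i / a : ℕ) : MonoidAlgebra k G) * MonoidAlgebra.of k G ((s * t) ^ i) := by
  classical
  -- per-term decomposition `i = i % a + a ⌊i/a⌋`, `(st)^i = s^{i % a} t^{i % e}`
  have hterm : ∀ i ∈ range (a * e),
      (i : MonoidAlgebra k G) * MonoidAlgebra.of k G ((s * t) ^ i)
        = ((i % a : ℕ) : MonoidAlgebra k G)
            * (MonoidAlgebra.of k G (s ^ (i % a)) * MonoidAlgebra.of k G (t ^ (i % e)))
          + (a : MonoidAlgebra k G)
            * (((i / a : ℕ) : MonoidAlgebra k G) * MonoidAlgebra.of k G ((s * t) ^ i)) := by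
    intro i _
    have hm : MonoidAlgebra.of k G ((s * t) ^ i)
        = MonoidAlgebra.of k G (s ^ (i % a)) * MonoidAlgebra.of k G (t ^ (i % e)) := by
      rw [mul_pow, map_mul, ← pow_eq_pow_mod i hs, ← pow_eq_pow_mod i ht]
    have hsc : (i : MonoidAlgebra k G)
        = ((i % a : ℕ) : MonoidAlgebra k G) + (a : MonoidAlgebra k G) * ((i / a : ℕ) : MonoidAlgebra k G) := by
      rw [← Nat.cast_mul, ← Nat.cast_add, Nat.mod_add_div]
    rw [← hm, ← mul_assoc (a : MonoidAlgebra k G), ← add_mul, ← hsc]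
  -- the CRT reindexing `i ↦ (i % a, i % e)` is a bijection `range (ae) → range a ×ˢ range e`
  have hmaps : ∀ i ∈ range (a * e), (fun i : ℕ => (i % a, i % e)) i ∈ range a ×ˢ range e := by
    intro i hi
    have hi' := mem_range.1 hi
    have ha : 0 < a := Nat.pos_of_ne_zero (by rintro rfl; simp at hi')
    have he : 0 < e := Nat.pos_of_ne_zero (by rintro rfl; simp at hi')
    simp only [mem_product, mem_range]
    exact ⟨Nat.mod_lt _ ha, Nat.mod_lt _ he⟩
  have hinj : Set.InjOn (fun i : ℕ => (i % a, i % e)) (range (a * e) : Finset ℕ) := by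
    intro i hi i' hi' h
    have hi₁ : i < a * e := mem_range.1 (mem_coe.1 hi)
    have hi₂ : i' < a * e := mem_range.1 (mem_coe.1 hi')
    simp only [Prod.mk.injEq] at h
    exact Nat.ModEq.eq_of_lt_of_lt ((Nat.modEq_and_modEq_iff_modEq_mul hae).1 ⟨h.1, h.2⟩) hi₁ hi₂
  have himg : (range (a * e)).image (fun i : ℕ => (i % a, i % e)) = range a ×ˢ range e := by
    apply eq_of_subset_of_card_le
    · intro x hx
      obtain ⟨i, hi, rfl⟩ := mem_image.1 hx
      exact hmaps i hi
    · simp only [card_image_of_injOn hinj, card_product, card_range, le_refl]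
  have hprod : (∑ j ∈ range a, (j : MonoidAlgebra k G) * MonoidAlgebra.of k G (s ^ j))
        * (∑ l ∈ range e, MonoidAlgebra.of k G (t ^ l))
      = ∑ x ∈ range a ×ˢ range e,
          ((x.1 : MonoidAlgebra k G) * MonoidAlgebra.of k G (s ^ x.1)) * MonoidAlgebra.of k G (t ^ x.2) := by
    rw [sum_product, sum_mul_sum]
  rw [hprod, ← himg, sum_image hinj, mul_sum, ← sum_add_distrib]
  refine sum_congr rfl fun i hi => ?_
  dsimp only
  rw [hterm i hi, mul_assoc]

/-- Divisibility form: `a ∣ D_{st} - D_s · N_{⟨t⟩}` in `k[G]`. -/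
theorem kolyvaginDerivative_crt_dvd {a e : ℕ} (hae : Nat.Coprime a e) (s t : G)
    (hs : s ^ a = 1) (ht : t ^ e = 1) :
    (a : MonoidAlgebra k G) ∣
      (∑ i ∈ range (a * e), (i : MonoidAlgebra k G) * MonoidAlgebra.of k G ((s * t) ^ i))
        - (∑ j ∈ range a, (j : MonoidAlgebra k G) * MonoidAlgebra.of k G (s ^ j))
            * (∑ l ∈ range e, MonoidAlgebra.of k G (t ^ l)) :=
  ⟨∑ i ∈ range (a * e), ((i / a : ℕ) : MonoidAlgebra k G) * MonoidAlgebra.of k G ((s * t) ^ i),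
    by rw [kolyvaginDerivative_crt hae s t hs ht, add_sub_cancel_left]⟩

/-- CRT components: an element `σ` with `σ ^ (a e) = 1`, `a, e` coprime, factors as `σ = σ^m · σ^n`
with `(σ^m) ^ a = 1`, `(σ^n) ^ e = 1` (so the previous lemmas apply to `D_σ` with `s = σ^m`, `t = σ^n`). -/
theorem exists_crt_components {a e : ℕ} (hae : Nat.Coprime a e) (σ : G) (hσ : σ ^ (a * e) = 1) :
    ∃ m n : ℕ, σ = σ ^ m * σ ^ n ∧ (σ ^ m) ^ a = 1 ∧ (σ ^ n) ^ e = 1 := by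
  obtain ⟨m, hm1, hm0⟩ := Nat.chineseRemainder hae 1 0
  obtain ⟨n, hn0, hn1⟩ := Nat.chineseRemainder hae 0 1
  refine ⟨m, n, ?_, ?_, ?_⟩
  · have h : m + n ≡ 1 [MOD a * e] :=
      (Nat.modEq_and_modEq_iff_modEq_mul hae).1
        ⟨by simpa using hm1.add hn0, by simpa using hm0.add hn1⟩
    rw [← pow_add, pow_eq_pow_mod (m + n) hσ, show (m + n) % (a * e) = 1 % (a * e) from h,
      ← pow_eq_pow_mod 1 hσ, pow_one]
  · obtain ⟨c, hc⟩ := Nat.modEq_zero_iff_dvd.1 hm0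
    rw [← pow_mul, hc, show e * c * a = (a * e) * c by ring, pow_mul, hσ, one_pow]
  · obtain ⟨c, hc⟩ := Nat.modEq_zero_iff_dvd.1 hn0
    rw [← pow_mul, hc, show a * c * e = (a * e) * c by ring, pow_mul, hσ, one_pow]

end KolyvaginDerivative

section BottomEvenPoint

/-! ## (a′)⁺ — where the factor `φ + φ⁻¹` comes from (the residual port made explicit)

In Kobayashi 2013, eq. (3.3) (`Tr_{1/0} d₁ + (σ + σ⁻¹) d₀ = a_p d₀`, over `W = W(k)`, `k` any perfect
field) and in B. D. Kim's relative Lubin–Tate construction (Compositio 143 (2007) §3.2: points `b_n`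
with `log b_n = λ_n + π_n − π_{n−2}/p + ⋯`, `λ_n = Σ_{j≥1} (−1)^{j−1} ψ^{−(n+2j)}(z) p^j`, and
`Tr_{L_n/L_{n−1}} π_n = −p·ψ^{−n}(z)` for the series `f_z = (X+z)^p − z^p`) the bottom point of the EVEN
(`+`) chain is `e₀ = Tr_Δ b₁` with `log e₀ = (p−1)λ₁ − p ψ^{−1}(z)`.  The purely formal identity
below (with `w k := ψ^{−k}(z)`, truncated at `J+1` terms, exact) says
`(ψ + ψ⁻¹) λ₀ = p·ψ^{−1}(z) + (1 − p)·λ₁ + (tail → 0)`, hence `log e₀ = −(ψ + ψ⁻¹) λ₀ = −(ψ+ψ⁻¹) log b₀`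
— the trace of the uniformizer CANCELS the `p ψ^{−1}(z)` term, in the relative Lubin–Tate tower exactly
as in the cyclotomic one.  So the `+` chain reaches the base only through `ψ + ψ⁻¹`, and the ONLY
`d`-sensitive input of the `+` structure theorem over an unramified base of degree `d` is the
invertibility of `ψ + ψ⁻¹` on `O_k = ℤ_p[Gal(k/ℚ_p)]` — i.e. `MonoidAlgebra.isUnit_of_add_of_inv` above
for `d` odd (all `d = 3^s` on the pro-`3` tower); the tower is carried by the linear coefficient `ξ` of
the relative Lubin–Tate series, the root of unity `z = ζ₀^i` only by `λ_n` and the `X^{p-1}`-coefficient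
(the trace), so the `d` generators live on one tower.  This is OUR READING of the port (a′)⁺ (card
`Ideas/one-point-squeeze.md`, g71 AMENDMENT (4)–(6)); the lemmas certify only the algebra. -/

/-- The bottom-even-point identity: for any sequence `w : ℕ → R` (think `w k = ψ^{-k} z`) and `p : R`,
`Σ_{i ≤ J} (−1)^i p^{i+1} (w(2i+1) + w(2i+3)) = p·w 1 + (1 − p)·Σ_{i ≤ J} (−1)^i p^{i+1} w(2i+3)
 + (−1)^J p^{J+2} w(2J+3)` — i.e. `(ψ+ψ⁻¹)λ₀ = p ψ⁻¹ z + (1−p) λ₁ +` a tail divisible by `p^{J+2}`. -/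
theorem bottom_even_point_identity {R : Type*} [CommRing R] (w : ℕ → R) (p : R) (J : ℕ) :
    ∑ i ∈ range (J + 1), (-1 : R) ^ i * p ^ (i + 1) * (w (2 * i + 1) + w (2 * i + 3))
      = p * w 1 + (1 - p) * ∑ i ∈ range (J + 1), (-1 : R) ^ i * p ^ (i + 1) * w (2 * i + 3)
        + (-1 : R) ^ J * p ^ (J + 2) * w (2 * J + 3) := by
  induction J with
  | zero => simp; ring
  | succ J ih =>
    rw [sum_range_succ, ih, sum_range_succ _ (J + 1)]
    have h1 : 2 * (J + 1) + 1 = 2 * J + 3 := by ring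
    have h2 : 2 * (J + 1) + 3 = 2 * J + 5 := by ring
    rw [h1, h2]
    ring

/-- Consequence used in the port: modulo `p^{J+2}` the bottom even point is `−(ψ+ψ⁻¹)` of the base point:
`(p − 1)·λ₁ − p·w 1 = −[(ψ+ψ⁻¹)λ₀] + (−1)^J p^{J+2} w(2J+3)` (same truncation). -/
theorem bottom_even_point_neg {R : Type*} [CommRing R] (w : ℕ → R) (p : R) (J : ℕ) :
    (p - 1) * (∑ i ∈ range (J + 1), (-1 : R) ^ i * p ^ (i + 1) * w (2 * i + 3)) - p * w 1
      = -(∑ i ∈ range (J + 1), (-1 : R) ^ i * p ^ (i + 1) * (w (2 * i + 1) + w (2 * i + 3)))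
        + (-1 : R) ^ J * p ^ (J + 2) * w (2 * J + 3) := by
  rw [bottom_even_point_identity]
  ring

end BottomEvenPoint

end Summit.BirchSwinnertonDyer.BirchSwinnertonDyer.Cruxes.TwinAlgMuZeroAtThree.OnePointSqueeze.ProThreeTower
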